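import Summits.QuantumFields.BalabanUV.Beta.D1BFx.NeedleDipPairings

/-!
# `BalabanUV.Beta.D1BFx.NeedleDipPairingsCoul` — road «BF-x» for binder row D1, slot (K), END row `hGrp gN`, «KK-PAIRINGS» PART 2: THE DIPOLE × FLAT TYPE (by
# parts at the pairing) AND THE COULOMB × COULOMB TYPES — `(ρ,ρ′)` critical and LOG-FREE `≤ C(1 + (1∕ε)∕nrm(u−v))`, `(ρ,δρ′)` and `(δρ,ρ′)` `≲ e^{−ε‖u−v‖}∕nrm(u−v)`

HONEST DEPENDENCY (cell records, verbatim): «continuum YM on T⁴ ⇐ BetaPertH ∧ nine spine estimates (0/9 proved); BetaPertH ⇐ (D1) ∧ (D4) ∧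
CAP+tail; G-an2-4 gates asym, D1 and NE2/3/4.»  HONEST FRAMING (cell contract, verbatim): «discharging `BetaPertH` makes Bałaban's UV stability
UNCONDITIONAL — a real constructive-QFT result; it is NOT the continuum limit and NOT the Clay problem.»  THIS MODULE DISCHARGES NOTHING of the
wall: [folklore] lattice bookkeeping over leaf-04-g9's HLS kit and PART 1 (`NeedleDipPairings`: `summable_mul_of_damped_flat∕profiles`, `sum_crit31_le`) in the
owner's rank-one frame; ABSTRACT leg `A` and functions — every letter is a HYPOTHESIS.  No `def`, no `def … : Prop`, nothing cited, 0 sorry.  Root-level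
binders hW ∕ hR-sockets ∕ hSX-socket ∕ D1Tel ∕ D1Rep — 0 discharged; (K) NOT closed; NOT D1, NOT `BetaPertH`, NOT continuum, NOT Clay.

WHY: see PART 1.  The `(δρ, δρ′)` type is NOT here (it needs the leg's Ward locality — the row file displays it as the hypothesis `h𝔅₂₂`).

CONTENT (`D = 4`, fibre `Fin 4`; common rate `ε > 0`; `𝕂ₐ(ε)` the kit's damped-flat constant, `C₄ = 373248`).
* [folklore] **`abs_pairing_dip_flat_le`** (`|⟨∇G, A∇F⟩| = |⟨G, A^{←}∇F⟩| ≤ 4·BG·(4kA₁BF𝕂₃(ε))·e^{−(ε∕4)‖u−v‖}·𝕂₃(ε∕2)`).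
* [folklore] **`abs_pairing_coul_coul_le`** (`≤ 4·BG·(4kA BF C₄)·(5859 + 4(1+216(1+2∕ε))∕nrm(u−v))`), **`abs_pairing_coul_dip_le`**, **`abs_pairing_dip_coul_le`**
  (`≤ 4·BG·(4kA₁BF C₄)·C₄·e^{−ε‖u−v‖}∕nrm(u−v)`).
Unit `b2b-balaban-beta-d1-formalise-leaf-04` (gen 9); `LEAVES-BFx.md` row (N) «KK-PAIRINGS» PART 2.
-/

noncomputable section

namespace Summit.QuantumFields.BalabanUV.Beta.D1BFx.NeedleDipPairingsCoul

open Finset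
open scoped BigOperators
open Literature.MathematicalPhysics.QuantumFieldTheory.Balaban1983to89
open Literature.MathematicalPhysics.QuantumFieldTheory.Balaban1983to89.Beta
open ExpKernelCalculus (Site MKer)
open AffineAveraging (unitVec)
open PoissonInterior (nrm nrm_pos one_le_nrm nrm_neg supNorm supNorm_neg supNorm_le_nrm)
open Summit.QuantumFields.BalabanUV.Beta.D1BFx.RankOneBubble (applyK pairing pairing_def pairing_comm)
open Summit.QuantumFields.BalabanUV.Beta.D1BFx.RankOneBubbleJets (grad grad_apply)
open Summit.QuantumFields.BalabanUV.Beta.D1BFx.LatticeHLSRadial (nrm_eq_max)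
open Summit.QuantumFields.BalabanUV.Beta.D1BFx.LatticeHLSProfiles (summable_and_abs_tsum_le_of_abs_sum_le)
open Summit.QuantumFields.BalabanUV.Beta.D1BFx.LatticeHLSPairing (abs_sum_fibre_mul_le)
open Summit.QuantumFields.BalabanUV.Beta.D1BFx.LatticeHLSDamped (abs_applyK_le_of_damped_profiles abs_pairing_le_of_damped_profiles
  abs_applyK_le_of_damped_flat abs_pairing_le_of_damped_flat)
open Summit.QuantumFields.BalabanUV.Beta.D1BFx.PairingByParts (pairing_grad_eq applyK_shift_sub abs_applyK_grad_le_of_damped_profiles)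
open Summit.QuantumFields.BalabanUV.Beta.D1BFx.NeedleDipPairings (summable_mul_of_damped_flat summable_mul_of_damped_profiles sum_crit31_le)

section Pairings

variable {A : MKer 4 (Fin 4)} {G F : Site 4 → ℝ} {kA kA' kA₁ BG BF ε : ℝ} (u v : Site 4)

/-- [folklore] **DIPOLE × FLAT (by parts at the pairing)**: the site dipole letter `|G| ≤ BG·e∕nrm(·−u)³`, `|∇F| ≤ BF·e` flat at `v`, the leg's entry letter and
backward first-site d1 letter `|A(x−e_a,y)_{ab} − A(x,y)_{ab}| ≤ kA₁e∕nrm³` ⇒ `|⟨∇G, A∇F⟩| = |⟨G, A^{←}∇F⟩| ≤ 4·BG·(4·kA₁·BF·𝕂₃(ε))·e^{−(ε∕4)‖u−v‖}·𝕂₃(ε∕2)`. -/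
theorem abs_pairing_dip_flat_le (hkA : 0 ≤ kA) (hkA₁ : 0 ≤ kA₁) (hBG : 0 ≤ BG) (hBF : 0 ≤ BF) (hε : 0 < ε)
    (hA0 : ∀ (x y : Site 4) (c b : Fin 4), |A x y c b| ≤ kA * Real.exp (-ε * supNorm (x - y)) / nrm (x - y) ^ 2)
    (hA1l : ∀ (x y : Site 4) (a b : Fin 4), |A (x - unitVec a) y a b - A x y a b| ≤ kA₁ * Real.exp (-ε * supNorm (x - y)) / nrm (x - y) ^ 3)
    (hG : ∀ x : Site 4, |G x| ≤ BG * Real.exp (-ε * supNorm (x - u)) / nrm (x - u) ^ 3)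
    (hF : ∀ (y : Site 4) (b : Fin 4), |grad F y b| ≤ BF * Real.exp (-ε * supNorm (y - v))) :
    |pairing (grad G) (applyK A (grad F))| ≤
      4 * BG * (4 * kA₁ * BF * (1 + 2 * ((4 : ℕ) : ℝ) * 3 ^ (4 - 1) * ((Nat.factorial (4 - 1 - 3) : ℝ) * (2 / (ε / 2)) ^ (4 - 1 - 3) * (1 + 2 / (ε / 2))))) * Real.exp (-(ε / 2 / 2) * supNorm (u - v)) * (1 + 2 * ((4 : ℕ) : ℝ) * 3 ^ (4 - 1) * ((Nat.factorial (4 - 1 - 3) : ℝ) * (2 / ((ε / 2) / 2)) ^ (4 - 1 - 3) * (1 + 2 / ((ε / 2) / 2)))) := by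
  have hε2 := half_pos hε
  -- the leg output is flat at rate ε/2
  have hχ : ∀ (x : Site 4) (c : Fin 4), |applyK A (grad F) x c| ≤ (4 * kA * BF * (1 + 2 * ((4 : ℕ) : ℝ) * 3 ^ (4 - 1) * ((Nat.factorial (4 - 1 - 2) : ℝ) * (2 / (ε / 2)) ^ (4 - 1 - 2) * (1 + 2 / (ε / 2))))) * Real.exp (-(ε / 2) * supNorm (x - v)) := by
    intro x c
    have h := abs_applyK_le_of_damped_flat (d := 4) (F := Fin 4) (by norm_num) (a := 2) (by norm_num) hkA hBF hε v hA0 hF x c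
    simp only [Fintype.card_fin] at h
    refine h.trans (le_of_eq ?_); push_cast; ring
  have hKχ : 0 ≤ 4 * kA * BF * (1 + 2 * ((4 : ℕ) : ℝ) * 3 ^ (4 - 1) * ((Nat.factorial (4 - 1 - 2) : ℝ) * (2 / (ε / 2)) ^ (4 - 1 - 2) * (1 + 2 / (ε / 2)))) := by positivity
  -- weaken a dipole letter to rate ε/2
  have hweak : ∀ (val : ℝ) (s : ℕ) (y : Site 4), val ≤ BG * Real.exp (-ε * s) / nrm y ^ 3 →
      val ≤ BG * Real.exp (-(ε / 2) * s) / nrm y ^ 3 := fun val s y h =>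
    h.trans (div_le_div_of_nonneg_right (mul_le_mul_of_nonneg_left (Real.exp_le_exp.2 (by
      have : (0 : ℝ) ≤ ε * s := by positivity
      nlinarith)) hBG) (pow_pos (nrm_pos _) 3).le)
  -- the two summabilities of `pairing_grad_eq`
  have h1 : ∀ a : Fin 4, Summable fun x : Site 4 => G x * applyK A (grad F) x a := fun a =>
    summable_mul_of_damped_flat (a := 3) le_rfl hBG hKχ hε2 u v (fun x => hweak _ _ _ (hG x)) (fun x => hχ x a)
  have h2 : ∀ a : Fin 4, Summable fun x : Site 4 => G x * applyK A (grad F) (x - unitVec a) a := by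
    intro a
    have hH : Summable fun z : Site 4 => G (z + unitVec a) * applyK A (grad F) z a :=
      summable_mul_of_damped_flat (a := 3) le_rfl hBG hKχ hε2 (u - unitVec a) v
        (fun z => hweak _ _ _ (by
          have e1 : z + unitVec a - u = z - (u - unitVec a) := by abel
          have h := hG (z + unitVec a); rwa [e1] at h)) (fun z => hχ z a)
    have h := (Equiv.subRight (unitVec a)).summable_iff.mpr hH
    refine h.congr fun x => ?_
    simp only [Function.comp, Equiv.subRight_apply, sub_add_cancel]
  rw [pairing_grad_eq G (applyK A (grad F)) h1 h2]
  -- the backward difference of the leg output is the output of the backward-differenced leg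
  have h1' : ∀ (x : Site 4) (a b : Fin 4), Summable fun y : Site 4 => A x y a b * grad F y b := fun x a b =>
    summable_mul_of_damped_flat (a := 2) (by norm_num) hkA hBF hε x v
      (fun y => by rw [← neg_sub x y, supNorm_neg, nrm_neg]; exact hA0 x y a b) (fun y => hF y b)
  have h2' : ∀ (x : Site 4) (a b : Fin 4), Summable fun y : Site 4 => A (x - unitVec a) y a b * grad F y b := fun x a b =>
    summable_mul_of_damped_flat (a := 2) (by norm_num) hkA hBF hε (x - unitVec a) v
      (fun y => by rw [← neg_sub (x - unitVec a) y, supNorm_neg, nrm_neg]; exact hA0 (x - unitVec a) y a b) (fun y => hF y b)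
  have eχ : (fun (x : Site 4) (a : Fin 4) => applyK A (grad F) (x - unitVec a) a - applyK A (grad F) x a)
      = applyK (fun x y a b => A (x - unitVec a) y a b - A x y a b) (grad F) :=
    funext fun x => funext fun a => applyK_shift_sub A (grad F) x a (h1' x a) (h2' x a)
  rw [eχ]
  -- flat out of the differenced leg (exponent 3), then dipole × flat
  have hχ' : ∀ (x : Site 4) (c : Fin 4), |applyK (fun x y a b => A (x - unitVec a) y a b - A x y a b) (grad F) x c|
      ≤ (4 * kA₁ * BF * (1 + 2 * ((4 : ℕ) : ℝ) * 3 ^ (4 - 1) * ((Nat.factorial (4 - 1 - 3) : ℝ) * (2 / (ε / 2)) ^ (4 - 1 - 3) * (1 + 2 / (ε / 2))))) * Real.exp (-(ε / 2) * supNorm (x - v)) := by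
    intro x c
    have h := abs_applyK_le_of_damped_flat (d := 4) (F := Fin 4) (by norm_num) (a := 3) (by norm_num)
      (A := fun x y a b => A (x - unitVec a) y a b - A x y a b) hkA₁ hBF hε v (fun x y c b => hA1l x y c b) hF x c
    simp only [Fintype.card_fin] at h
    refine h.trans (le_of_eq ?_); push_cast; ring
  have hK' : 0 ≤ 4 * kA₁ * BF * (1 + 2 * ((4 : ℕ) : ℝ) * 3 ^ (4 - 1) * ((Nat.factorial (4 - 1 - 3) : ℝ) * (2 / (ε / 2)) ^ (4 - 1 - 3) * (1 + 2 / (ε / 2)))) := by positivity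
  have h := abs_pairing_le_of_damped_flat (d := 4) (F := Fin 4) (by norm_num) (a := 3) (by norm_num) hBG hK' hε2 u v
    (ψ := fun (x : Site 4) (_ : Fin 4) => G x) (fun x _ => hweak _ _ _ (hG x)) hχ'
  simp only [Fintype.card_fin] at h
  refine h.2.trans (le_of_eq ?_); push_cast; ring

/-! ## The Coulomb × Coulomb pairing types -/

/-- [folklore] **COULOMB × COULOMB — THE CRITICAL TYPE, LOG-FREE**: `|∇G| ≤ BG·e∕nrm(·−u)³`, `|∇F| ≤ BF·e∕nrm(·−v)³` ⇒
`|⟨∇G, A∇F⟩| ≤ 4·BG·(4·kA·BF·C₄)·(5859 + 4(1+216(1+2∕ε))∕nrm(u−v))` (profiles `(2,3) ↦ 1` in the leg, then `sum_crit31_le`). -/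
theorem abs_pairing_coul_coul_le (hkA : 0 ≤ kA) (hBG : 0 ≤ BG) (hBF : 0 ≤ BF) (hε : 0 < ε)
    (hA0 : ∀ (x y : Site 4) (c b : Fin 4), |A x y c b| ≤ kA * Real.exp (-ε * supNorm (x - y)) / nrm (x - y) ^ 2)
    (hG : ∀ (x : Site 4) (a : Fin 4), |grad G x a| ≤ BG * Real.exp (-ε * supNorm (x - u)) / nrm (x - u) ^ 3)
    (hF : ∀ (y : Site 4) (b : Fin 4), |grad F y b| ≤ BF * Real.exp (-ε * supNorm (y - v)) / nrm (y - v) ^ 3) :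
    |pairing (grad G) (applyK A (grad F))| ≤ 4 * BG * (4 * kA * BF * 373248) * (5859 + 4 * (1 + 216 * (1 + 2 / ε)) / nrm (u - v)) := by
  have hAF : ∀ (x : Site 4) (c : Fin 4), |applyK A (grad F) x c| ≤ (4 * kA * BF * 373248) * Real.exp (-ε * supNorm (x - v)) / nrm (x - v) ^ 1 := by
    intro x c
    have h := abs_applyK_le_of_damped_profiles (d := 4) (F := Fin 4) (by norm_num) (a := 2) (b := 3) (by norm_num) (by norm_num) (by norm_num)
      hkA hBF hε.le v hA0 hF x c
    simp only [Fintype.card_fin] at h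
    norm_num at h ⊢
    exact h
  set KF : ℝ := 4 * kA * BF * 373248 with hKF
  have hKF0 : 0 ≤ KF := by positivity
  have hnuv := nrm_pos (d := 4) (u - v)
  have hS : ∀ S : Finset (Site 4), ∑ x ∈ S, |∑ c, grad G x c * applyK A (grad F) x c| ≤
      4 * BG * KF * (5859 + 4 * (1 + 216 * (1 + 2 / ε)) / nrm (u - v)) := by
    intro S
    have hpt : ∀ x ∈ S, |∑ c, grad G x c * applyK A (grad F) x c| ≤ (4 : ℕ) *
        (BG * Real.exp (-ε * supNorm (x - u)) / nrm (x - u) ^ 3 * (KF * Real.exp (-ε * supNorm (x - v)) / nrm (x - v) ^ 1)) := by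
      intro x _
      have := nrm_pos (d := 4) (x - u)
      have h := abs_sum_fibre_mul_le (F := Fin 4) (by positivity) x (hG x) (hAF x)
      simpa only [Fintype.card_fin] using h
    have hle : ∀ x ∈ S, (4 : ℕ) * (BG * Real.exp (-ε * supNorm (x - u)) / nrm (x - u) ^ 3 * (KF * Real.exp (-ε * supNorm (x - v)) / nrm (x - v) ^ 1))
        ≤ 4 * BG * KF * (Real.exp (-ε * supNorm (x - v)) / (nrm (x - u) ^ 3 * nrm (x - v))) := by
      intro x _
      have hxu := pow_pos (nrm_pos (d := 4) (x - u)) 3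
      have hxv := nrm_pos (d := 4) (x - v)
      have hexp : Real.exp (-ε * supNorm (x - u)) ≤ 1 := by
        rw [Real.exp_le_one_iff]; have : (0 : ℝ) ≤ ε * supNorm (x - u) := by positivity
        linarith
      rw [pow_one]
      have e1 : ((4 : ℕ) : ℝ) * (BG * Real.exp (-ε * supNorm (x - u)) / nrm (x - u) ^ 3 * (KF * Real.exp (-ε * supNorm (x - v)) / nrm (x - v)))
          = 4 * BG * KF * (Real.exp (-ε * supNorm (x - v)) / (nrm (x - u) ^ 3 * nrm (x - v))) * Real.exp (-ε * supNorm (x - u)) := by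
        push_cast; ring
      rw [e1]
      exact mul_le_of_le_one_right (by positivity) hexp
    calc ∑ x ∈ S, |∑ c, grad G x c * applyK A (grad F) x c|
        ≤ ∑ x ∈ S, 4 * BG * KF * (Real.exp (-ε * supNorm (x - v)) / (nrm (x - u) ^ 3 * nrm (x - v))) :=
          Finset.sum_le_sum fun x hx => (hpt x hx).trans (hle x hx)
      _ = 4 * BG * KF * ∑ x ∈ S, Real.exp (-ε * supNorm (x - v)) / (nrm (x - u) ^ 3 * nrm (x - v)) := by rw [Finset.mul_sum]
      _ ≤ 4 * BG * KF * (5859 + 4 * (1 + 216 * (1 + 2 / ε)) / nrm (u - v)) :=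
          mul_le_mul_of_nonneg_left (sum_crit31_le hε S u v) (by positivity)
  have h := summable_and_abs_tsum_le_of_abs_sum_le hS
  rw [pairing_def]; exact h.2

/-- [folklore] **COULOMB × DIPOLE (by parts in the leg)**: `|∇G| ≤ BG·e∕nrm(·−u)³`, the site dipole letter `|F| ≤ BF·e∕nrm(·−v)³`, the leg's entry letters and
backward second-site d1 letter ⇒ `|⟨∇G, A∇F⟩| ≤ 4·BG·(4·kA₁·BF·C₄)·C₄·e^{−ε‖u−v‖}∕nrm(u−v)` (`(3,3) ↦ 2` in the leg, then `(3,2) ↦ 1`). -/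
theorem abs_pairing_coul_dip_le (hkA : 0 ≤ kA) (hkA' : 0 ≤ kA') (hkA₁ : 0 ≤ kA₁) (hBG : 0 ≤ BG) (hBF : 0 ≤ BF) (hε : 0 < ε)
    (hA0 : ∀ (x y : Site 4) (c b : Fin 4), |A x y c b| ≤ kA * Real.exp (-ε * supNorm (x - y)) / nrm (x - y) ^ 2)
    (hA0r : ∀ (x y : Site 4) (c b : Fin 4), |A x (y - unitVec b) c b| ≤ kA' * Real.exp (-ε * supNorm (x - y)) / nrm (x - y) ^ 2)
    (hA1r : ∀ (x y : Site 4) (c b : Fin 4), |A x (y - unitVec b) c b - A x y c b| ≤ kA₁ * Real.exp (-ε * supNorm (x - y)) / nrm (x - y) ^ 3)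
    (hG : ∀ (x : Site 4) (a : Fin 4), |grad G x a| ≤ BG * Real.exp (-ε * supNorm (x - u)) / nrm (x - u) ^ 3)
    (hF : ∀ y : Site 4, |F y| ≤ BF * Real.exp (-ε * supNorm (y - v)) / nrm (y - v) ^ 3) :
    |pairing (grad G) (applyK A (grad F))| ≤ 4 * BG * (4 * kA₁ * BF * 373248) * 373248 * Real.exp (-ε * supNorm (u - v)) / nrm (u - v) ^ 1 := by
  have hAF : ∀ (x : Site 4) (c : Fin 4), |applyK A (grad F) x c| ≤ (4 * kA₁ * BF * 373248) * Real.exp (-ε * supNorm (x - v)) / nrm (x - v) ^ 2 := by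
    intro x c
    have h := abs_applyK_grad_le_of_damped_profiles hkA hkA' hkA₁ hBF hε.le v hA0 hA0r hA1r hF x c
    norm_num at h ⊢
    exact h
  have hK : 0 ≤ 4 * kA₁ * BF * 373248 := by positivity
  have h := abs_pairing_le_of_damped_profiles (d := 4) (F := Fin 4) (by norm_num) (a := 3) (b := 2) (by norm_num) (by norm_num) (by norm_num)
    hBG hK hε.le u v hG hAF
  simp only [Fintype.card_fin] at h
  norm_num at h ⊢
  exact h.2

/-- [folklore] **DIPOLE × COULOMB (by parts at the pairing)**: the site dipole letter `|G| ≤ BG·e∕nrm(·−u)³`, `|∇F| ≤ BF·e∕nrm(·−v)³`, the leg's entry letter and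
backward first-site d1 letter ⇒ `|⟨∇G, A∇F⟩| = |⟨G, A^{←}∇F⟩| ≤ 4·BG·(4·kA₁·BF·C₄)·C₄·e^{−ε‖u−v‖}∕nrm(u−v)` (`(3,3) ↦ 2`, then `(3,2) ↦ 1`). -/
theorem abs_pairing_dip_coul_le (hkA : 0 ≤ kA) (hkA₁ : 0 ≤ kA₁) (hBG : 0 ≤ BG) (hBF : 0 ≤ BF) (hε : 0 < ε)
    (hA0 : ∀ (x y : Site 4) (c b : Fin 4), |A x y c b| ≤ kA * Real.exp (-ε * supNorm (x - y)) / nrm (x - y) ^ 2)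
    (hA1l : ∀ (x y : Site 4) (a b : Fin 4), |A (x - unitVec a) y a b - A x y a b| ≤ kA₁ * Real.exp (-ε * supNorm (x - y)) / nrm (x - y) ^ 3)
    (hG : ∀ x : Site 4, |G x| ≤ BG * Real.exp (-ε * supNorm (x - u)) / nrm (x - u) ^ 3)
    (hF : ∀ (y : Site 4) (b : Fin 4), |grad F y b| ≤ BF * Real.exp (-ε * supNorm (y - v)) / nrm (y - v) ^ 3) :
    |pairing (grad G) (applyK A (grad F))| ≤ 4 * BG * (4 * kA₁ * BF * 373248) * 373248 * Real.exp (-ε * supNorm (u - v)) / nrm (u - v) ^ 1 := by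
  -- the leg output is Coulomb-1, in particular flat
  have hχ : ∀ (x : Site 4) (c : Fin 4), |applyK A (grad F) x c| ≤ (4 * kA * BF * 373248) * Real.exp (-ε * supNorm (x - v)) / nrm (x - v) ^ 1 := by
    intro x c
    have h := abs_applyK_le_of_damped_profiles (d := 4) (F := Fin 4) (by norm_num) (a := 2) (b := 3) (by norm_num) (by norm_num) (by norm_num)
      hkA hBF hε.le v hA0 hF x c
    simp only [Fintype.card_fin] at h
    norm_num at h ⊢
    exact h
  have hKχ : 0 ≤ 4 * kA * BF * 373248 := by positivity
  have hχflat : ∀ (w x : Site 4) (c : Fin 4), |applyK A (grad F) x c| ≤ (4 * kA * BF * 373248) * Real.exp (-ε * supNorm (x - v)) / nrm (x - v) ^ 1 →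
      |applyK A (grad F) x c| ≤ (4 * kA * BF * 373248) * Real.exp (-ε * supNorm (x - v)) := fun w x c h =>
    h.trans (by rw [pow_one]; exact div_le_self (by positivity) (one_le_nrm _))
  -- the two summabilities of `pairing_grad_eq`
  have h1 : ∀ a : Fin 4, Summable fun x : Site 4 => G x * applyK A (grad F) x a := fun a =>
    summable_mul_of_damped_flat (a := 3) le_rfl hBG hKχ hε u v hG (fun x => hχflat u x a (hχ x a))
  have h2 : ∀ a : Fin 4, Summable fun x : Site 4 => G x * applyK A (grad F) (x - unitVec a) a := by
    intro a
    have hH : Summable fun z : Site 4 => G (z + unitVec a) * applyK A (grad F) z a :=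
      summable_mul_of_damped_flat (a := 3) le_rfl hBG hKχ hε (u - unitVec a) v
        (fun z => by
          have e1 : z + unitVec a - u = z - (u - unitVec a) := by abel
          have h := hG (z + unitVec a); rwa [e1] at h) (fun z => hχflat u z a (hχ z a))
    have h := (Equiv.subRight (unitVec a)).summable_iff.mpr hH
    refine h.congr fun x => ?_
    simp only [Function.comp, Equiv.subRight_apply, sub_add_cancel]
  rw [pairing_grad_eq G (applyK A (grad F)) h1 h2]
  have h1' : ∀ (x : Site 4) (a b : Fin 4), Summable fun y : Site 4 => A x y a b * grad F y b := fun x a b =>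
    summable_mul_of_damped_profiles (a := 2) (b := 3) (by norm_num) le_rfl (by norm_num) hkA hBF hε.le x v
      (fun y => by rw [← neg_sub x y, supNorm_neg, nrm_neg]; exact hA0 x y a b) (fun y => hF y b)
  have h2' : ∀ (x : Site 4) (a b : Fin 4), Summable fun y : Site 4 => A (x - unitVec a) y a b * grad F y b := fun x a b =>
    summable_mul_of_damped_profiles (a := 2) (b := 3) (by norm_num) le_rfl (by norm_num) hkA hBF hε.le (x - unitVec a) v
      (fun y => by rw [← neg_sub (x - unitVec a) y, supNorm_neg, nrm_neg]; exact hA0 (x - unitVec a) y a b) (fun y => hF y b)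
  have eχ : (fun (x : Site 4) (a : Fin 4) => applyK A (grad F) (x - unitVec a) a - applyK A (grad F) x a)
      = applyK (fun x y a b => A (x - unitVec a) y a b - A x y a b) (grad F) :=
    funext fun x => funext fun a => applyK_shift_sub A (grad F) x a (h1' x a) (h2' x a)
  rw [eχ]
  have hχ' : ∀ (x : Site 4) (c : Fin 4), |applyK (fun x y a b => A (x - unitVec a) y a b - A x y a b) (grad F) x c|
      ≤ (4 * kA₁ * BF * 373248) * Real.exp (-ε * supNorm (x - v)) / nrm (x - v) ^ 2 := by
    intro x c
    have h := abs_applyK_le_of_damped_profiles (d := 4) (F := Fin 4) (by norm_num) (a := 3) (b := 3) (by norm_num) (by norm_num) (by norm_num)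
      (A := fun x y a b => A (x - unitVec a) y a b - A x y a b) (φ := grad F) hkA₁ hBF hε.le v (fun x y c b => hA1l x y c b) hF x c
    simp only [Fintype.card_fin] at h
    norm_num at h ⊢
    exact h
  have hK' : 0 ≤ 4 * kA₁ * BF * 373248 := by positivity
  have h := abs_pairing_le_of_damped_profiles (d := 4) (F := Fin 4) (by norm_num) (a := 3) (b := 2) (by norm_num) (by norm_num) (by norm_num)
    hBG hK' hε.le u v (ψ := fun (x : Site 4) (_ : Fin 4) => G x) (fun x _ => hG x) hχ'
  simp only [Fintype.card_fin] at h
  norm_num at h ⊢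
  exact h.2

end Pairings

end Summit.QuantumFields.BalabanUV.Beta.D1BFx.NeedleDipPairingsCoul

end
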